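import Summits.AtomisticToContinuum.Crystallization.Theorems.ChargedEnergyGapRotationTest
import HarnessLib

/-!
(SPLIT FOR THE 400-LINE CAP by the landing lane, hand-2 g31: this file = part 1 of 2; sequels `…ChargedEnergyGapSiteStressFree` import it in a chain; same namespace, all FQNs unchanged.)
# `ChargedEnergyGap` — the (R2) RE-TYPING: the designate pair over SITE-STRESS-FREE references, its record cones, its witness, and the
# symmetry toolkit for `IsSiteStressFree` (cell `decomp-a2c`, lens 3, generation 62, node «SiteStressFree», part P-N; over part P-M
# `…Theorems.ChargedEnergyGapRotationTest`)

WHY (critic rows 1131 (b), 1137 (D)(v); memo g61 §9.5, memo g62 §0–§2).  The designate transfer piece of generation 61,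
(H𝄪ʳ) `LocalSeamTransferBoundR`, is FALSE-leaning AS TYPED by the ROT-OSC census (P-M header): coherent two-block superpolytype references are
admissible (separated, labelled, force-free, stress-FREE IN THE CELL SUM, stable modulo rotations) but carry opposite per-layer site virials
`±f·1.10·10⁻³`, against which the rotation cocycle — admissible test data, zero quadratic energy in the cell — books a first-order debit linear in the
slab thickness of the centre set.  The re-typing (R2) restricts the references the transfer piece must serve to SITE-stress-free ones (`IsSiteStressFree`,
part P-M: every site virial vanishes; fcc and hcp are, no other Barlow stacking is) and moves polytypic / faulted far matter to the REDUCTION, which charts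
it on fcc/hcp plus COMPLETE COHERENT STACKING SEAMS — invisible to the transfer piece and needing NO excision (part P-O `…ChargedEnergyGapSeamAbsorption`,
the seam ledger of memo g62 §0: PAYABLE, ratio `≤ 10⁻³`, not the `27` feared in row 1137 (D)(ii), whose premise was crossing-bond excision).

WHAT THIS FILE DOES (all `[this work]`; no `sorry`, no new axioms).
§N1 ★ THE RE-TYPED DESIGNATE PAIR: (H𝄪ˢ) `LocalSeamTransferBoundS` = (H𝄪ʳ) VERBATIM with `IsStressFree P` replaced by `IsSiteStressFree P`, and (N𝄪ˢ)
  `LocalSeamReductionS := (H𝄪ˢ) → CB-FAR_W|cored,B₀`; the glue `farLabelledFloorCoredBudgetW_of_localS` (modus ponens); the ORDER: (H𝄪ʳ) ⟹ (H𝄪ˢ)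
  (`localSeamTransferBoundS_of_R`, fewer references to serve — (H𝄪ˢ) is WEAKER), (N𝄪ˢ) ⟹ (N𝄪ʳ) (`localSeamReductionR_of_S` — (N𝄪ˢ) is STRONGER: the
  reduction may now only call the transfer piece on site-stress-free references) and leaf ⟹ (N𝄪ˢ); dial monotonicity; the CREDIT forms (H𝄪♯ˢ)(κ_D)
  `LocalSeamTransferCreditS` / (N𝄪♯ˢ) `LocalSeamCreditReductionS` likewise, with (H𝄪♯ˢ) ⟹ (H𝄪ˢ) for `κ_D ≥ 0` and (H𝄪♯ʳ) ⟹ (H𝄪♯ˢ).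
§N2 ★ THE ROTATION INSTANCES ARE DISCHARGED under (R2): for every site-stress-free reference, every centre set, every localisation, NO excision and NO
  seams, the conclusion of (H𝄪ˢ) holds for the rotation cocycle with ANY `C_T, Cχ, C_H ≥ 0` (`localS_conclusion_rotField`: the model is `0` by P-M's
  `modelFarL_rotField_eq_zero`, the allowances are non-negative) — the (F1)/(F2) violation tables of the census are tables of NON-instances of (H𝄪ˢ).
§N3 ★★ RECORD CONES: `chargedEnergyGap_of_localLedgerS` (any weight system, any `ϱ`), `chargedEnergyGap_of_maxCoverLocalLedgerS_record` (ϱ = 160 —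
  THE RECORD-DESIGNATE OF GENERATION 62) and the credit cone `chargedEnergyGap_of_maxCoverCreditLedgerS_record` (κ_D = 1/800); consistency: the
  generation-61 cones are RECOVERED from the new ones (`chargedEnergyGap_of_localLedgerS_of_R`).
§N4 ★★ THE WITNESS: the hypothesis block of (H𝄪ˢ) at the record dials is inhabited by P-L/P-M's `fccRef a₀` (`hypothesisBlockS_record_inhabited` =
  P-M `Fcc.exists_admissible_siteStressFree_harmStableModRot`), and the rotation instance of §N2 evaluates there to `0 ≤ 0`-type truths.
§N5 ★ THE SYMMETRY TOOLKIT for `IsSiteStressFree` beyond one-point motifs (hcp-ready; critic row 1137 (D)(v)(a) «hcp lemma owed»): the site virial is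
  COVARIANT under every affine isometry `q ↦ g q + c` stabilising the point set (`siteVirial_symm : T_{g y + c}(a, b) = T_y(g⁻¹a, g⁻¹b)`), INVARIANT under
  period translations (`siteVirial_add_lattice`), and ★ a stress-free reference all of whose motif site virials COINCIDE is site-stress-free
  (`isSiteStressFree_of_forall_eq`: `q·T = Σ T = 0`); combined: ★ `isSiteStressFree_of_symm` — if every motif site is the image of one site `y₁` under a
  point-set symmetry whose linear part fixes `T_{y₁}`, the reference is site-stress-free; ★★ `isSiteStressFree_of_motif_pair` /
  `isSiteStressFree_of_card_motif_le_two`: EVERY stress-free periodic configuration with AT MOST TWO atoms per primitive cell is site-stress-free (the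
  inversion through the mid-point of the two sublattices stabilises the point set and has linear part `−1`) — THE OWED hcp LEMMA in reference-free
  form, INSTANTIATED at the tree's `hcpPeriodicConfiguration ha hh` for every `(a, h)` (`hcp_isSiteStressFree_of_isStressFree`; and at every
  Barlow configuration of Hägg period `≤ 2`); dhcp (period 4) is not covered, consistently with the census.
-/

noncomputable section

open scoped Classical
open Literature.MathematicalPhysics.StatisticalMechanics
open Literature.Geometry.DiscreteGeometry
open Summit.AtomisticToContinuum.Crystallization.Theses.PricedLinkCensus
open Summit.AtomisticToContinuum.Crystallization.Theorems.ChargedEnergyGapNegative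

namespace Summit.AtomisticToContinuum.Crystallization.Theorems.ChargedEnergyGapChartDial

/-! ## §N1 ★ The (R2) re-typed designate pair (H𝄪ˢ)/(N𝄪ˢ) and its credit form -/

section PairS

variable (s lam ℓ μ₀ τ lamQ ϱ b₀ r_S C_T ϱχ Cχ : ℝ)

/-- piece LOCAL-TRANSFERˢ(`C_T`, `Cχ`, `ϱχ`) · **THE (R2) RE-TYPED (H𝄪ʳ)**: the localised seam transfer bound VERBATIM, with the equilibrium
hypothesis `IsStressFree P` (cell virial `= 0`) STRENGTHENED to `IsSiteStressFree P` (every site virial `= 0`) · WEAKER than (H𝄪ʳ)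
(`localSeamTransferBoundS_of_R`) · UNDECIDED→TRUE-leaning at the record (ROT-OSC void without excision, P-M; the rotation instances discharged, §N2;
complete seam stacks invisible, P-O; remaining test data = genuine strain fields, for which the census engines C11/C13/C15/χCOST measured the
constants) · INSTRUMENTABLE · ATTACKABLE-M+.  Why it might fail: the (R2) EXCISION TERM of memo g61 §9.5 (rotation × excised collar: `3.3·10⁻⁴` per
priced site `< C_H = 10⁻³`, tail `2·10⁻⁸·Area` vs `0.09·Area`) if a collar geometry beats the charging scheme of memo g62 §1.2; a curved-shell /
creased-χ strain instance not sampled by C11/χCOST. -/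
def LocalSeamTransferBoundS : Prop :=
  ∃ C_H : ℝ, 0 ≤ C_H ∧ ∀ (P : PeriodicConfiguration 3) (C X : Set E3) (β₀ : E3 → E3 → E3) (k : ℕ) (S : Fin k → CutPiece)
    (m : ℕ) (D : Fin m → Set E3) (σ : Fin m → Bool),
    IsSeparatedRef s P → IsLabelledRef lam ℓ P → IsForceFree P → IsSiteStressFree P → HarmStableModRot μ₀ P →
    IsInvariantSet P C → IsInvariantSet P X → IsGlobalCocycle P β₀ → IsSeamSystem b₀ r_S P S →
    SmallStrain τ P X (volterraField P S β₀) → (∀ i, IsInvariantSet P (D i)) →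
      -(C_T * shellMassL ϱχ D σ P X ϱ C) - Cχ * transMassL ϱχ D σ P X ϱ C - C_H * (pricedNearCountL ϱχ D σ P X ϱ C : ℝ) ≤
        modelFarL ϱχ D σ (volterraField P S β₀) P X lamQ ϱ C

variable {s lam ℓ μ₀ τ lamQ ϱ b₀ r_S C_T ϱχ Cχ}

/-- ★ **(H𝄪ʳ) ⟹ (H𝄪ˢ)**: the re-typed piece serves FEWER references (site-stress-free ones are stress-free, `IsSiteStressFree.isStressFree`). -/
theorem localSeamTransferBoundS_of_R (h : LocalSeamTransferBoundR s lam ℓ μ₀ τ lamQ ϱ b₀ r_S C_T ϱχ Cχ) :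
    LocalSeamTransferBoundS s lam ℓ μ₀ τ lamQ ϱ b₀ r_S C_T ϱχ Cχ := by
  obtain ⟨C_H, hH, h⟩ := h
  exact ⟨C_H, hH, fun P C X β₀ k S m D σ h1 h2 h3 h4 h5 h6 h7 h8 h9 h10 h11 =>
    h P C X β₀ k S m D σ h1 h2 h3 h4.isStressFree h5 h6 h7 h8 h9 h10 h11⟩

/-- (H𝄪ˢ) is monotone in the stability margin it assumes … -/
theorem LocalSeamTransferBoundS.mono_mu {μ₀' : ℝ} (hμ : μ₀ ≤ μ₀') (h : LocalSeamTransferBoundS s lam ℓ μ₀ τ lamQ ϱ b₀ r_S C_T ϱχ Cχ) :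
    LocalSeamTransferBoundS s lam ℓ μ₀' τ lamQ ϱ b₀ r_S C_T ϱχ Cχ := by
  obtain ⟨C_H, hH, h⟩ := h
  exact ⟨C_H, hH, fun P C X β₀ k S m D σ h1 h2 h3 h4 h5 h6 h7 h8 h9 h10 h11 =>
    h P C X β₀ k S m D σ h1 h2 h3 h4 (h5.anti hμ) h6 h7 h8 h9 h10 h11⟩

/-- … in the transfer constant `C_T` … -/
theorem LocalSeamTransferBoundS.mono_CT {C_T' : ℝ} (hC : C_T ≤ C_T') (h : LocalSeamTransferBoundS s lam ℓ μ₀ τ lamQ ϱ b₀ r_S C_T ϱχ Cχ) :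
    LocalSeamTransferBoundS s lam ℓ μ₀ τ lamQ ϱ b₀ r_S C_T' ϱχ Cχ := by
  obtain ⟨C_H, hH, h⟩ := h
  refine ⟨C_H, hH, fun P C X β₀ k S m D σ h1 h2 h3 h4 h5 h6 h7 h8 h9 h10 h11 => le_trans ?_ (h P C X β₀ k S m D σ h1 h2 h3 h4 h5 h6 h7 h8 h9 h10 h11)⟩
  have := shellMassL_nonneg (ϱχ := ϱχ) (D := D) (σ := σ) P X ϱ C
  nlinarith

/-- … and in the transition constant `Cχ`. -/
theorem LocalSeamTransferBoundS.mono_Cchi {Cχ' : ℝ} (hC : Cχ ≤ Cχ') (h : LocalSeamTransferBoundS s lam ℓ μ₀ τ lamQ ϱ b₀ r_S C_T ϱχ Cχ) :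
    LocalSeamTransferBoundS s lam ℓ μ₀ τ lamQ ϱ b₀ r_S C_T ϱχ Cχ' := by
  obtain ⟨C_H, hH, h⟩ := h
  refine ⟨C_H, hH, fun P C X β₀ k S m D σ h1 h2 h3 h4 h5 h6 h7 h8 h9 h10 h11 => le_trans ?_ (h P C X β₀ k S m D σ h1 h2 h3 h4 h5 h6 h7 h8 h9 h10 h11)⟩
  have := transMassL_nonneg (ϱχ := ϱχ) (D := D) (σ := σ) P X ϱ C
  nlinarith

variable (s lam ℓ μ₀ τ lamQ ϱ b₀ r_S C_T ϱχ Cχ)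
variable {θ ε R r η L δ L' : ℝ} (W : CoreWeights θ ε R r η L δ L' ϱ) (c₁ ρ₀ B₀ : ℝ)

/-- piece LOCAL-REDUCTIONˢ_W · **THE (R2) RE-TYPED (N𝄪ʳ)**: the re-typed transfer bound implies the budget far leaf · STRONGER than (N𝄪ʳ)
(`localSeamReductionR_of_S`), WEAKER than the leaf (`localSeamReductionS_of_budget`) · UNDECIDED (TRUE-leaning with the leaf for the max cover) ·
ATTACKABLE-L.  Proof obligations: those of (N𝄪ʳ) (part P-I(2/2)), EXCEPT that every reference handed to the transfer piece must now be
SITE-stress-free — so polytypic and faulted Barlow far matter (dhcp, 9R, random stackings, isolated faults) is charted on fcc or hcp plus COMPLETE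
COHERENT STACKING SEAMS absorbed into the base cocycle (part P-O: no excision, transfer instance = the seamless one), the reduction paying the seam's
slot errors from the layer stacking energies `≥ e*` and the `(1 − λ)` quadratic reserve (memo g62 §0: ratio `≤ 10⁻³`); PLUS the supercell
presentations this requires re-open `HarmStableModRot (1/100)` at the supercell's Bloch momenta (STAB-61 (S): certified in floating point, fcc `0.019`,
hcp `0.027`; kernel-owed «STAB-k»). -/
def LocalSeamReductionS : Prop :=
  LocalSeamTransferBoundS s lam ℓ μ₀ τ lamQ ϱ b₀ r_S C_T ϱχ Cχ → FarLabelledFloorCoredBudgetW W c₁ s ρ₀ lam ℓ B₀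

variable {s lam ℓ μ₀ τ lamQ ϱ b₀ r_S C_T ϱχ Cχ W c₁ ρ₀ B₀}

/-- ★ **THE SPLIT** (glue, proved; bridge split by modus ponens): LOCAL-TRANSFERˢ ∧ LOCAL-REDUCTIONˢ_W ⟹ CB-FAR_W|cored,`B₀`. -/
theorem farLabelledFloorCoredBudgetW_of_localS (hS : LocalSeamTransferBoundS s lam ℓ μ₀ τ lamQ ϱ b₀ r_S C_T ϱχ Cχ)
    (hN : LocalSeamReductionS s lam ℓ μ₀ τ lamQ ϱ b₀ r_S C_T ϱχ Cχ W c₁ ρ₀ B₀) : FarLabelledFloorCoredBudgetW W c₁ s ρ₀ lam ℓ B₀ :=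
  hN hS

/-- ★ STRONGER: (N𝄪ˢ) ⟹ (N𝄪ʳ) (the reduction's hypothesis got weaker). -/
theorem localSeamReductionR_of_S (h : LocalSeamReductionS s lam ℓ μ₀ τ lamQ ϱ b₀ r_S C_T ϱχ Cχ W c₁ ρ₀ B₀) :
    LocalSeamReductionR s lam ℓ μ₀ τ lamQ ϱ b₀ r_S C_T ϱχ Cχ W c₁ ρ₀ B₀ :=
  fun hR => h (localSeamTransferBoundS_of_R hR)

/-- WEAKER than the leaf: CB-FAR_W|cored,`B₀` ⟹ (N𝄪ˢ). -/
theorem localSeamReductionS_of_budget (h : FarLabelledFloorCoredBudgetW W c₁ s ρ₀ lam ℓ B₀) :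
    LocalSeamReductionS s lam ℓ μ₀ τ lamQ ϱ b₀ r_S C_T ϱχ Cχ W c₁ ρ₀ B₀ :=
  fun _ => h

/-- (N𝄪ˢ) is antitone in the stability margin … -/
theorem LocalSeamReductionS.anti_mu {μ₀' : ℝ} (hμ : μ₀ ≤ μ₀') (h : LocalSeamReductionS s lam ℓ μ₀' τ lamQ ϱ b₀ r_S C_T ϱχ Cχ W c₁ ρ₀ B₀) :
    LocalSeamReductionS s lam ℓ μ₀ τ lamQ ϱ b₀ r_S C_T ϱχ Cχ W c₁ ρ₀ B₀ :=
  fun hS => h (hS.mono_mu hμ)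

/-- … antitone in `C_T` … -/
theorem LocalSeamReductionS.anti_CT {C_T' : ℝ} (hC : C_T' ≤ C_T) (h : LocalSeamReductionS s lam ℓ μ₀ τ lamQ ϱ b₀ r_S C_T ϱχ Cχ W c₁ ρ₀ B₀) :
    LocalSeamReductionS s lam ℓ μ₀ τ lamQ ϱ b₀ r_S C_T' ϱχ Cχ W c₁ ρ₀ B₀ :=
  fun hS => h (hS.mono_CT hC)

/-- … antitone in `Cχ` … -/
theorem LocalSeamReductionS.anti_Cchi {Cχ' : ℝ} (hC : Cχ' ≤ Cχ) (h : LocalSeamReductionS s lam ℓ μ₀ τ lamQ ϱ b₀ r_S C_T ϱχ Cχ W c₁ ρ₀ B₀) :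
    LocalSeamReductionS s lam ℓ μ₀ τ lamQ ϱ b₀ r_S C_T ϱχ Cχ' W c₁ ρ₀ B₀ :=
  fun hS => h (hS.mono_Cchi hC)

/-- … and monotone in the leaf's dials `(c₁, B₀)`. -/
theorem LocalSeamReductionS.mono_c {c₁' B₀' : ℝ} (hc : c₁ ≤ c₁') (hB : B₀' ≤ B₀)
    (h : LocalSeamReductionS s lam ℓ μ₀ τ lamQ ϱ b₀ r_S C_T ϱχ Cχ W c₁ ρ₀ B₀) :
    LocalSeamReductionS s lam ℓ μ₀ τ lamQ ϱ b₀ r_S C_T ϱχ Cχ W c₁' ρ₀ B₀' :=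
  fun hS => ((h hS).mono W hc).anti W hB

/-! ### The credit forms (H𝄪♯ˢ)/(N𝄪♯ˢ) -/

/-- piece LOCAL-TRANSFER♯ˢ(`C_T`, `Cχ`, `ϱχ`, `κ_D`) · the (R2) re-typing of the CREDIT form (H𝄪♯ʳ) (part P-I(2/2)): VERBATIM with `IsSiteStressFree P`
· WEAKER than (H𝄪♯ʳ) (`localSeamTransferCreditS_of_R`), STRONGER than (H𝄪ˢ) for `κ_D ≥ 0` (`localSeamTransferBoundS_of_creditS`) · UNDECIDED→TRUE-leaning
at the record `κ_D = 1/800` · INSTRUMENTABLE · ATTACKABLE-M+. -/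
def LocalSeamTransferCreditS (s lam ℓ μ₀ τ lamQ ϱ b₀ r_S C_T ϱχ Cχ κ_D : ℝ) : Prop :=
  ∃ C_H : ℝ, 0 ≤ C_H ∧ ∀ (P : PeriodicConfiguration 3) (C X : Set E3) (β₀ : E3 → E3 → E3) (k : ℕ) (S : Fin k → CutPiece)
    (m : ℕ) (D : Fin m → Set E3) (σ : Fin m → Bool),
    IsSeparatedRef s P → IsLabelledRef lam ℓ P → IsForceFree P → IsSiteStressFree P → HarmStableModRot μ₀ P →
    IsInvariantSet P C → IsInvariantSet P X → IsGlobalCocycle P β₀ → IsSeamSystem b₀ r_S P S →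
    SmallStrain τ P X (volterraField P S β₀) → (∀ i, IsInvariantSet P (D i)) →
      ∃ r₀ v : E3,
        -(C_T * shellMassL ϱχ D σ P X ϱ C) - Cχ * transMassL ϱχ D σ P X ϱ C - C_H * (pricedNearCountL ϱχ D σ P X ϱ C : ℝ) +
            κ_D * creditL ϱχ D σ (gaugedField (volterraField P S β₀) r₀ v) P X ϱ C ≤
          modelFarL ϱχ D σ (volterraField P S β₀) P X lamQ ϱ C

/-- ★ (H𝄪♯ʳ)(κ_D) ⟹ (H𝄪♯ˢ)(κ_D). -/
theorem localSeamTransferCreditS_of_R {κ_D : ℝ} (h : LocalSeamTransferCreditR s lam ℓ μ₀ τ lamQ ϱ b₀ r_S C_T ϱχ Cχ κ_D) :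
    LocalSeamTransferCreditS s lam ℓ μ₀ τ lamQ ϱ b₀ r_S C_T ϱχ Cχ κ_D := by
  obtain ⟨C_H, hH, h⟩ := h
  exact ⟨C_H, hH, fun P C X β₀ k S m D σ h1 h2 h3 h4 h5 h6 h7 h8 h9 h10 h11 =>
    h P C X β₀ k S m D σ h1 h2 h3 h4.isStressFree h5 h6 h7 h8 h9 h10 h11⟩

/-- ★ (H𝄪♯ˢ)(κ_D) ⟹ (H𝄪ˢ) for `κ_D ≥ 0` (drop the non-negative credit). -/
theorem localSeamTransferBoundS_of_creditS {κ_D : ℝ} (hκ : 0 ≤ κ_D) (h : LocalSeamTransferCreditS s lam ℓ μ₀ τ lamQ ϱ b₀ r_S C_T ϱχ Cχ κ_D) :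
    LocalSeamTransferBoundS s lam ℓ μ₀ τ lamQ ϱ b₀ r_S C_T ϱχ Cχ := by
  obtain ⟨C_H, hH, h⟩ := h
  refine ⟨C_H, hH, fun P C X β₀ k S m D σ h1 h2 h3 h4 h5 h6 h7 h8 h9 h10 h11 => ?_⟩
  obtain ⟨r₀, v, hle⟩ := h P C X β₀ k S m D σ h1 h2 h3 h4 h5 h6 h7 h8 h9 h10 h11
  have hc := mul_nonneg hκ (creditL_nonneg ϱχ D σ (gaugedField (volterraField P S β₀) r₀ v) P X ϱ C)
  linarith

/-- (H𝄪♯ˢ) is antitone in the credit rate. -/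
theorem LocalSeamTransferCreditS.anti_kappa {κ_D κ_D' : ℝ} (hκ : κ_D' ≤ κ_D)
    (h : LocalSeamTransferCreditS s lam ℓ μ₀ τ lamQ ϱ b₀ r_S C_T ϱχ Cχ κ_D) : LocalSeamTransferCreditS s lam ℓ μ₀ τ lamQ ϱ b₀ r_S C_T ϱχ Cχ κ_D' := by
  obtain ⟨C_H, hH, h⟩ := h
  refine ⟨C_H, hH, fun P C X β₀ k S m D σ h1 h2 h3 h4 h5 h6 h7 h8 h9 h10 h11 => ?_⟩
  obtain ⟨r₀, v, hle⟩ := h P C X β₀ k S m D σ h1 h2 h3 h4 h5 h6 h7 h8 h9 h10 h11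
  refine ⟨r₀, v, le_trans ?_ hle⟩
  have hc := creditL_nonneg ϱχ D σ (gaugedField (volterraField P S β₀) r₀ v) P X ϱ C
  nlinarith

/-- At `κ_D = 0` the credit form IS the plain form. -/
theorem localSeamTransferCreditS_zero_iff :
    LocalSeamTransferCreditS s lam ℓ μ₀ τ lamQ ϱ b₀ r_S C_T ϱχ Cχ 0 ↔ LocalSeamTransferBoundS s lam ℓ μ₀ τ lamQ ϱ b₀ r_S C_T ϱχ Cχ := by
  refine ⟨localSeamTransferBoundS_of_creditS le_rfl, fun ⟨C_H, hH, h⟩ => ⟨C_H, hH, fun P C X β₀ k S m D σ h1 h2 h3 h4 h5 h6 h7 h8 h9 h10 h11 =>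
    ⟨0, 0, ?_⟩⟩⟩
  have := h P C X β₀ k S m D σ h1 h2 h3 h4 h5 h6 h7 h8 h9 h10 h11
  simpa using this

/-- piece LOCAL-CREDIT-REDUCTIONˢ_W(`κ_D`) · the (R2) re-typing of (N𝄪♯ʳ): the credit form implies the budget far leaf · STRONGER than (N𝄪♯ʳ)
(`localSeamCreditReductionR_of_S`), WEAKER than (N𝄪ˢ) for `κ_D ≥ 0` (`localSeamCreditReductionS_of_S`) and than the leaf · UNDECIDED · ATTACKABLE-L
(obligations of (N𝄪ˢ), with the gauged Dirichlet credit as typed payer of bending / gentle twist, part P-I(2/2) §4). -/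
def LocalSeamCreditReductionS (s lam ℓ μ₀ τ lamQ ϱ b₀ r_S C_T ϱχ Cχ κ_D : ℝ) {θ ε R r η L δ L' : ℝ} (W : CoreWeights θ ε R r η L δ L' ϱ)
    (c₁ ρ₀ B₀ : ℝ) : Prop :=
  LocalSeamTransferCreditS s lam ℓ μ₀ τ lamQ ϱ b₀ r_S C_T ϱχ Cχ κ_D → FarLabelledFloorCoredBudgetW W c₁ s ρ₀ lam ℓ B₀

/-- ★ Glue of the credit split: (H𝄪♯ˢ) ∧ (N𝄪♯ˢ) ⟹ CB-FAR_W|cored,`B₀`. -/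
theorem farLabelledFloorCoredBudgetW_of_creditS {κ_D : ℝ} (hS : LocalSeamTransferCreditS s lam ℓ μ₀ τ lamQ ϱ b₀ r_S C_T ϱχ Cχ κ_D)
    (hN : LocalSeamCreditReductionS s lam ℓ μ₀ τ lamQ ϱ b₀ r_S C_T ϱχ Cχ κ_D W c₁ ρ₀ B₀) : FarLabelledFloorCoredBudgetW W c₁ s ρ₀ lam ℓ B₀ :=
  hN hS

/-- STRONGER: (N𝄪♯ˢ) ⟹ (N𝄪♯ʳ). -/
theorem localSeamCreditReductionR_of_S {κ_D : ℝ} (h : LocalSeamCreditReductionS s lam ℓ μ₀ τ lamQ ϱ b₀ r_S C_T ϱχ Cχ κ_D W c₁ ρ₀ B₀) :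
    LocalSeamCreditReductionR s lam ℓ μ₀ τ lamQ ϱ b₀ r_S C_T ϱχ Cχ κ_D W c₁ ρ₀ B₀ :=
  fun hR => h (localSeamTransferCreditS_of_R hR)

/-- WEAKER: (N𝄪ˢ) ⟹ (N𝄪♯ˢ)(κ_D) for `κ_D ≥ 0`. -/
theorem localSeamCreditReductionS_of_S {κ_D : ℝ} (hκ : 0 ≤ κ_D) (h : LocalSeamReductionS s lam ℓ μ₀ τ lamQ ϱ b₀ r_S C_T ϱχ Cχ W c₁ ρ₀ B₀) :
    LocalSeamCreditReductionS s lam ℓ μ₀ τ lamQ ϱ b₀ r_S C_T ϱχ Cχ κ_D W c₁ ρ₀ B₀ :=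
  fun hS => h (localSeamTransferBoundS_of_creditS hκ hS)

/-- WEAKER than the leaf. -/
theorem localSeamCreditReductionS_of_budget {κ_D : ℝ} (h : FarLabelledFloorCoredBudgetW W c₁ s ρ₀ lam ℓ B₀) :
    LocalSeamCreditReductionS s lam ℓ μ₀ τ lamQ ϱ b₀ r_S C_T ϱχ Cχ κ_D W c₁ ρ₀ B₀ :=
  fun _ => h

/-- (N𝄪♯ˢ) is monotone in the credit rate. -/
theorem LocalSeamCreditReductionS.mono_kappa {κ_D κ_D' : ℝ} (hκ : κ_D ≤ κ_D')
    (h : LocalSeamCreditReductionS s lam ℓ μ₀ τ lamQ ϱ b₀ r_S C_T ϱχ Cχ κ_D W c₁ ρ₀ B₀) :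
    LocalSeamCreditReductionS s lam ℓ μ₀ τ lamQ ϱ b₀ r_S C_T ϱχ Cχ κ_D' W c₁ ρ₀ B₀ :=
  fun hS => h (hS.anti_kappa hκ)

end PairS

/-! ## §N2 ★ The rotation instances of (H𝄪ˢ) are DISCHARGED (the census tables (F1)/(F2) are non-instances under (R2)) -/

section RotInstance

variable {P : PeriodicConfiguration 3} (ϱχ : ℝ) {m : ℕ} (D : Fin m → Set E3) (σ : Fin m → Bool)

/-- ★ For a SITE-stress-free reference, every centre set, every localisation list and pattern, NO excision and NO seams, the conclusion of
(H𝄪ˢ) for the rotation cocycle `rotField r₀ v` holds with EVERY `C_T, Cχ, C_H ≥ 0`: its right-hand side is `0` (P-M `modelFarL_rotField_eq_zero`,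
`volterraField_fin_zero`) and its left-hand side is `≤ 0`.  This is exactly the family of instances on which the census found (H𝄪ʳ) violated
(profile form (F1): `m = 0`; localised form (F2): `m = 1`) — for references that are stress-free only in the cell sum. -/
theorem localS_conclusion_rotField (hS : IsSiteStressFree P) {C_T Cχ C_H : ℝ} (hT : 0 ≤ C_T) (hχ : 0 ≤ Cχ) (hH : 0 ≤ C_H) (lamQ ϱ : ℝ)
    (C : Set E3) (S : Fin 0 → CutPiece) (r₀ v : E3) :
    -(C_T * shellMassL ϱχ D σ P ∅ ϱ C) - Cχ * transMassL ϱχ D σ P ∅ ϱ C - C_H * (pricedNearCountL ϱχ D σ P ∅ ϱ C : ℝ) ≤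
      modelFarL ϱχ D σ (volterraField P S (rotField r₀ v)) P ∅ lamQ ϱ C := by
  rw [volterraField_fin_zero, modelFarL_rotField_eq_zero hS]
  have h1 := shellMassL_nonneg (ϱχ := ϱχ) (D := D) (σ := σ) P ∅ ϱ C
  have h2 := transMassL_nonneg (ϱχ := ϱχ) (D := D) (σ := σ) P ∅ ϱ C
  have h3 : (0 : ℝ) ≤ (pricedNearCountL ϱχ D σ P ∅ ϱ C : ℝ) := Nat.cast_nonneg _
  nlinarith [mul_nonneg hT h1, mul_nonneg hχ h2, mul_nonneg hH h3]

/-- The same for the CREDIT form with the rotation's own gauge: the gauged field of `rotField r₀ v` by `(r₀, v)` is `0`, so the credit term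
vanishes too (`gaugedField_rotField_self`). -/
theorem localCreditS_conclusion_rotField (hS : IsSiteStressFree P) {C_T Cχ C_H : ℝ} (hT : 0 ≤ C_T) (hχ : 0 ≤ Cχ) (hH : 0 ≤ C_H)
    (κ_D lamQ ϱ : ℝ) (C : Set E3) (S : Fin 0 → CutPiece) (r₀ v : E3) :
    ∃ r₁ v₁ : E3,
      -(C_T * shellMassL ϱχ D σ P ∅ ϱ C) - Cχ * transMassL ϱχ D σ P ∅ ϱ C - C_H * (pricedNearCountL ϱχ D σ P ∅ ϱ C : ℝ) +
          κ_D * creditL ϱχ D σ (gaugedField (volterraField P S (rotField r₀ v)) r₁ v₁) P ∅ ϱ C ≤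
        modelFarL ϱχ D σ (volterraField P S (rotField r₀ v)) P ∅ lamQ ϱ C := by
  refine ⟨r₀, v, ?_⟩
  have hcr : creditL ϱχ D σ (gaugedField (volterraField P S (rotField r₀ v)) r₀ v) P ∅ ϱ C = 0 := by
    rw [volterraField_fin_zero, gaugedField_rotField_self]
    simp [creditL, dirichletSiteX]
  rw [hcr, mul_zero, add_zero]
  exact localS_conclusion_rotField ϱχ D σ hS hT hχ hH lamQ ϱ C S r₀ v

end RotInstance

/-! ## §N3 ★★ Record cones over the (R2) pieces -/

section RecordS

/-- ★★ **THE TEN-LEAF RECORD CONE FOR EVERY WEIGHT SYSTEM, (R2)-RE-TYPED**: `ChargeRecount · IP_G · FCP_G · CCP_G · REG-BALL_W · LABEL_W ·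
SHELL-BUDGET_W(10⁵) · LOCAL-TRANSFERˢ(1/(3·10⁶), 10⁻⁵, 80) · LOCAL-REDUCTIONˢ_W · P_G ⟹ ChargedEnergyGap` at the record dials, any `ϱ`, any `W`. -/
theorem chargedEnergyGap_of_localLedgerS {ϱ : ℝ} (W : CoreWeights (3 / 20) (1 / 10) (6 / 5) 10 (1 / 100) 40 (1 / 10) 40 ϱ)
    (hF : ChargeRecount)
    (hIP : ImprovablePricingG (3 / 20) (1 / 10) (6 / 5) 10 (1 / 100) (3 / 5))
    (hFCP : FrustratedCorePricingG (3 / 20) (1 / 10) (6 / 5) 10 (1 / 100) 40 (3 / 5))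
    (hCCP : CoherentCorePricingG (3 / 20) (1 / 10) (6 / 5) 10 (1 / 100) 40 (1 / 10) 40 (3 / 5))
    (hB : CoreBallRegularPricingW W (1 / 20) (3 / 5) 10 fun _ _ => True)
    (hLab : CleanLabellingW W (3 / 5) 10 (1 / 3) 3)
    (hSB : ShellBudgetW W (3 / 5) 100000)
    (hS : LocalSeamTransferBoundS (3 / 5) (1 / 3) 3 (1 / 100) (3 / 100) (1 / 2) ϱ (2 / 5) 3 (1 / 3000000) 80 (1 / 100000))
    (hN : LocalSeamReductionS (3 / 5) (1 / 3) 3 (1 / 100) (3 / 100) (1 / 2) ϱ (2 / 5) 3 (1 / 3000000) 80 (1 / 100000) W (1 / 20) 10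
      100000)
    (hP : ChartedChargePricingG (3 / 20) (1 / 10) (3 / 5)) : ChargedEnergyGap :=
  chargedEnergyGap_of_budgetLedger W hF hIP hFCP hCCP hB hLab hSB (farLabelledFloorCoredBudgetW_of_localS hS hN) hP

/-- ★★ **THE MAX-COVER TEN-LEAF RECORD CONE, (R2)-RE-TYPED** at `ϱ = 160` — THE RECORD-DESIGNATE OF GENERATION 62: `ChargeRecount · IP_G · FCP_G ·
CCP_G · REG-BALL_M · LABEL_M · SHELL-BUDGET_M(10⁵) · LOCAL-TRANSFERˢ(1/(3·10⁶), 10⁻⁵, 80) · LOCAL-REDUCTIONˢ_M · P_G ⟹ ChargedEnergyGap`. -/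
theorem chargedEnergyGap_of_maxCoverLocalLedgerS_record (hF : ChargeRecount)
    (hIP : ImprovablePricingG (3 / 20) (1 / 10) (6 / 5) 10 (1 / 100) (3 / 5))
    (hFCP : FrustratedCorePricingG (3 / 20) (1 / 10) (6 / 5) 10 (1 / 100) 40 (3 / 5))
    (hCCP : CoherentCorePricingG (3 / 20) (1 / 10) (6 / 5) 10 (1 / 100) 40 (1 / 10) 40 (3 / 5))
    (hB : CoreBallRegularPricingW (maxCoverWeights (3 / 20) (1 / 10) (6 / 5) 10 (1 / 100) 40 (1 / 10) 40 160) (1 / 20) (3 / 5) 10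
      fun _ _ => True)
    (hLab : CleanLabellingW (maxCoverWeights (3 / 20) (1 / 10) (6 / 5) 10 (1 / 100) 40 (1 / 10) 40 160) (3 / 5) 10 (1 / 3) 3)
    (hSB : ShellBudgetW (maxCoverWeights (3 / 20) (1 / 10) (6 / 5) 10 (1 / 100) 40 (1 / 10) 40 160) (3 / 5) 100000)
    (hS : LocalSeamTransferBoundS (3 / 5) (1 / 3) 3 (1 / 100) (3 / 100) (1 / 2) 160 (2 / 5) 3 (1 / 3000000) 80 (1 / 100000))
    (hN : LocalSeamReductionS (3 / 5) (1 / 3) 3 (1 / 100) (3 / 100) (1 / 2) 160 (2 / 5) 3 (1 / 3000000) 80 (1 / 100000)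
      (maxCoverWeights (3 / 20) (1 / 10) (6 / 5) 10 (1 / 100) 40 (1 / 10) 40 160) (1 / 20) 10 100000)
    (hP : ChartedChargePricingG (3 / 20) (1 / 10) (3 / 5)) : ChargedEnergyGap :=
  chargedEnergyGap_of_maxCoverBudgetLedger_record hF hIP hFCP hCCP hB hLab hSB (farLabelledFloorCoredBudgetW_of_localS hS hN) hP

/-- ★★ **THE MAX-COVER CREDIT CONE, (R2)-RE-TYPED** at `ϱ = 160`, `κ_D = 1/800` (alternative designate): `… · LOCAL-TRANSFER♯ˢ(1/(3·10⁶), 10⁻⁵, 80,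
1/800) · LOCAL-CREDIT-REDUCTIONˢ_M(1/800) · P_G ⟹ ChargedEnergyGap`. -/
theorem chargedEnergyGap_of_maxCoverCreditLedgerS_record (hF : ChargeRecount)
    (hIP : ImprovablePricingG (3 / 20) (1 / 10) (6 / 5) 10 (1 / 100) (3 / 5))
    (hFCP : FrustratedCorePricingG (3 / 20) (1 / 10) (6 / 5) 10 (1 / 100) 40 (3 / 5))
    (hCCP : CoherentCorePricingG (3 / 20) (1 / 10) (6 / 5) 10 (1 / 100) 40 (1 / 10) 40 (3 / 5))
    (hB : CoreBallRegularPricingW (maxCoverWeights (3 / 20) (1 / 10) (6 / 5) 10 (1 / 100) 40 (1 / 10) 40 160) (1 / 20) (3 / 5) 10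
      fun _ _ => True)
    (hLab : CleanLabellingW (maxCoverWeights (3 / 20) (1 / 10) (6 / 5) 10 (1 / 100) 40 (1 / 10) 40 160) (3 / 5) 10 (1 / 3) 3)
    (hSB : ShellBudgetW (maxCoverWeights (3 / 20) (1 / 10) (6 / 5) 10 (1 / 100) 40 (1 / 10) 40 160) (3 / 5) 100000)
    (hS : LocalSeamTransferCreditS (3 / 5) (1 / 3) 3 (1 / 100) (3 / 100) (1 / 2) 160 (2 / 5) 3 (1 / 3000000) 80 (1 / 100000) (1 / 800))
    (hN : LocalSeamCreditReductionS (3 / 5) (1 / 3) 3 (1 / 100) (3 / 100) (1 / 2) 160 (2 / 5) 3 (1 / 3000000) 80 (1 / 100000) (1 / 800)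
      (maxCoverWeights (3 / 20) (1 / 10) (6 / 5) 10 (1 / 100) 40 (1 / 10) 40 160) (1 / 20) 10 100000)
    (hP : ChartedChargePricingG (3 / 20) (1 / 10) (3 / 5)) : ChargedEnergyGap :=
  chargedEnergyGap_of_maxCoverBudgetLedger_record hF hIP hFCP hCCP hB hLab hSB (farLabelledFloorCoredBudgetW_of_creditS hS hN) hP

/-- Consistency: the (R2) cone RECOVERS the generation-61 cone (its (H𝄪ˢ) leaf is implied by (H𝄪ʳ), its (N𝄪ˢ) leaf implies (N𝄪ʳ) — so a proof
of the g61 pair also feeds the g62 cone: instantiate `hN` with `localSeamReductionR`'s proof is NOT possible, the direction is the other one; what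
IS possible is to feed (H𝄪ʳ) into the g62 transfer slot). -/
theorem chargedEnergyGap_of_localLedgerS_of_R {ϱ : ℝ} (W : CoreWeights (3 / 20) (1 / 10) (6 / 5) 10 (1 / 100) 40 (1 / 10) 40 ϱ)
    (hF : ChargeRecount)
    (hIP : ImprovablePricingG (3 / 20) (1 / 10) (6 / 5) 10 (1 / 100) (3 / 5))
    (hFCP : FrustratedCorePricingG (3 / 20) (1 / 10) (6 / 5) 10 (1 / 100) 40 (3 / 5))
    (hCCP : CoherentCorePricingG (3 / 20) (1 / 10) (6 / 5) 10 (1 / 100) 40 (1 / 10) 40 (3 / 5))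
    (hB : CoreBallRegularPricingW W (1 / 20) (3 / 5) 10 fun _ _ => True)
    (hLab : CleanLabellingW W (3 / 5) 10 (1 / 3) 3)
    (hSB : ShellBudgetW W (3 / 5) 100000)
    (hR : LocalSeamTransferBoundR (3 / 5) (1 / 3) 3 (1 / 100) (3 / 100) (1 / 2) ϱ (2 / 5) 3 (1 / 3000000) 80 (1 / 100000))
    (hN : LocalSeamReductionS (3 / 5) (1 / 3) 3 (1 / 100) (3 / 100) (1 / 2) ϱ (2 / 5) 3 (1 / 3000000) 80 (1 / 100000) W (1 / 20) 10
      100000)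
    (hP : ChartedChargePricingG (3 / 20) (1 / 10) (3 / 5)) : ChargedEnergyGap :=
  chargedEnergyGap_of_localLedgerS W hF hIP hFCP hCCP hB hLab hSB (localSeamTransferBoundS_of_R hR) hN hP

end RecordS

end Summit.AtomisticToContinuum.Crystallization.Theorems.ChargedEnergyGapChartDial

end
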